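import Summits.Ventures.PercRepro.C041TreeZoneBridgeF
import Summits.Ventures.PercRepro.C041ZoneIso

/-!
# ROW C-041 — THEOREM (trees) on every zone isomorphic to the zone of a tree (p6, gen 29)

`C041TreeZoneBridge` proves mine-3's CONJECTURES (ZONE O-CUBE) and (ZONE CS) on the CANONICAL zone `TZ.toZone t` of
a rooted marked tree; `C041ZoneIso` transports both along any zone isomorphism.  Together: any abstract zone `Z`
with a zone isomorphism `φ : ZoneIso t.toZone Z` satisfies both conjectures for the anchor `φ.v t.root` — the form
in which the tree theorem applies to a zone given by its own vertex / edge / mark types.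
-/

namespace PercRepro

namespace TreeClosure

open ZoneZ ZoneZ.ZoneData

variable {V E T₁ T₂ : Type*} [Fintype E] [DecidableEq E] [Fintype T₁] [DecidableEq T₁] [Fintype T₂]
  [DecidableEq T₂]

/-- **THE ZONE O-CUBE on every zone isomorphic to a tree zone**, anchored at the image of the root. -/
theorem TZ.zoneOCubeConj_of_iso (t : TZ) {Z : ZoneData V E T₁ T₂} (φ : ZoneIso t.toZone Z) :
    Z.ZoneOCubeConj {φ.v t.root} (∅ : Set V) :=
  (φ.zoneOCubeConj_iff t.root).2 t.zoneOCubeConj_toZone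

/-- **The one-anchor (CS) on every zone isomorphic to a tree zone**, anchored at the image of the root. -/
theorem TZ.zoneCSConj_of_iso (t : TZ) {Z : ZoneData V E T₁ T₂} (φ : ZoneIso t.toZone Z) :
    Z.ZoneCSConj {φ.v t.root} (∅ : Set V) :=
  (φ.zoneCSConj_iff t.root).2 t.zoneCSConj_toZone

/-- The forced-edge form on every zone isomorphic to a tree zone. -/
theorem TZ.zoneOCubeConjF_of_iso (t : TZ) {Z : ZoneData V E T₁ T₂} (φ : ZoneIso t.toZone Z) :
    Z.toFZone.ZoneOCubeConjF {φ.v t.root} (∅ : Set V) :=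
  (zoneOCubeConjF_toFZone_iff _ _ _).2 (t.zoneOCubeConj_of_iso φ)

end TreeClosure

end PercRepro
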